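import Summits.BirchSwinnertonDyer.BirchSwinnertonDyer.Theorems.ByReductionTypeAtTwoFineSelmerConjAAtTwoAdditivePotGoodAscentStampsA
import HarnessLib

/-!
# C4″ `AdditivePotMultOverKAtTwo` (item stmt-BirchSwinnertonDyer-22618), the (I1M′) input of the upper half on the `Δ < 0` rows:
# KERNEL STAMPS, part M — Iwasawa's `μ₂ = 0` (ZERO hypotheses) for the `2`-torsion cubic fields `d = -11336` and UNCONDITIONAL
# statement (A) at `2` for the C4″ census curves 453440cv1

Cell `bsd-2adic`, rung K4, seat `bsd-2adic-k4-w3` GEN 11 (explicit unit of director-bsd g16 (309)(7); `--supports stmt-BirchSwinnertonDyer-22618`).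
HONEST FRAMING (D-0036/D-0054/D-0152): THEOREMS ONLY (no definition, no named fact, no `sorry`). FIELD PART (unconditional kernel arithmetic about an
explicit cubic field `ℚ(θ)`; generator = eng-2's polredabs cubic when its index `[𝓞 : ℤ[θ]]` is odd, else an odd-index second generator):
`irreducible_cubic_<d>`, `odd_classNumber_of_root_<d>` (norm certificate below the Minkowski bound; k4-w1's `odd_classNumber_of_cubeCertificate`),
**`classicalMu_two_cubicField_<d>`** = `μ = 0` (growth form) along EVERY cyclotomic `ℤ₂`-extension of `ℚ(θ)` from `e₀ = 0` (odd `h`), `e₁ = 0` (k4-w1's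
Chevalley door at `2`, `layerOneBit_of_chevalleyCert`: a unit with `2`-adic image `≡ ±3 (mod 8)` is not a norm from `ℚ(θ, √2)`; ≤ 2 primes above `2`),
`n₀ = 0` (odd cubic discriminant `…_of_odd_cubic_discr`, or `2 = 𝔭𝔮²` with an even-index certificate `…_of_evenIndexCertificate`) and Fukuda 1994 Thm. 1 (1)
(`_holds`). These fields have TWO primes above `2` (the `2`-division cubic of a potentially multiplicative curve has a `ℚ₂`-root). ROW PART:
`conjA_two_<L>'` = Coates–Sujatha's statement (A) at `p = 2` for the census cubic model of the Cremona class (a-invariants of addL2x GEN 13's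
`nst_census-j313647.tsv`), PROVED OUTRIGHT: field identification `ℚ(β) = ℚ(θ)` + cruxlead-19573-w2's door
`TotallyComplexMu.conjA_two_cubicModel_of_classicalMu_of_discr_neg` (kernel Lim 3.5@2 + `ℓ = 2` ascent). Certificates (norm witnesses, fundamental units by a
relation sieve, Hensel data, even-index elements) found by the seat's exact-arithmetic tools (`work/tools/`) and CHECKED HERE by the kernel; eng-2's
census CERT-ADD-POTMULT-FUKUDA269-E2 agrees (`μ₂ = λ₂ = 0`, bnfcertify). Statement (A) is NOT BSD: BSD₂ for these curves is not proved; C4″ / (I1M′) stay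
research-open; nothing booked; no row of 22618 changes tier (pen RC-490 (4)). Pattern/toolkit: k4-w1 GEN 5–8 (`…MuTwoKernelRows{A,B}`, `…AscentStampsA`).

References: [CoatesSujatha2005] Conj. A, Thm. 3.4; [Iwasawa1973MuInvariants] Thm. 2/3; [Fukuda1994] Thm. 1 (1); [Lang1990] Ch. 13 §4 Lemma 4.1;
[Washington1997] §13.1; [Marcus1977] Ch. 5 Thm. 35–37; [Cohen1993] §6.3; [Lim2017FineSelmer] §3; cell files `eng2/fukuda269/{TABLE,LAYERS}-…-E2-v1.tsv`.
-/

set_option autoImplicit false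
-- sibling precedent (`…MuTwoKernelRowsA.lean`): the directory name repeats the summit name
set_option linter.dupNamespace false

noncomputable section
open scoped Classical IntermediateField NumberField Real nonZeroDivisors
namespace Summit.BirchSwinnertonDyer.BirchSwinnertonDyer.Theorems.AddKatoTwo
open WeierstrassCurve Field Polynomial IsDedekindDomain NumberField Matrix Literature.NumberTheory.EllipticCurves
  Literature.NumberTheory.GaloisRepresentations
  Literature.NumberTheory.IwasawaTheory
  Summit.BirchSwinnertonDyer.BirchSwinnertonDyer.Theorems.SteinbergFibreAtTwo
  Summit.BirchSwinnertonDyer.BirchSwinnertonDyer.Theorems.AlignedTransportAtTwoTorsionPointField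
  Summit.BirchSwinnertonDyer.BirchSwinnertonDyer.Theses.ByReductionTypeAtTwo

/-! ## The cubic field of discriminant `-11336` (`X³ + (-1)X² + (-14)X + (34)`, index `1`; C4″ rows 453440cv1) -/

/-- `X³ + (-1)X² + (-14)X + (34)` is irreducible over `ℚ` (no root mod `3`). -/
theorem irreducible_cubic_d11336n : Irreducible (Cubic.toPoly ⟨1, ((-1 : ℤ) : ℚ), ((-14 : ℤ) : ℚ), ((34 : ℤ) : ℚ)⟩) :=
  haveI : Fact (Nat.Prime 3) := ⟨by norm_num⟩
  irreducible_cubic_of_no_root_zmod 3 (by decide)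

section Certd11336n

variable (K : Type) [Field K] [NumberField K]

/-- **`h` is ODD for every cubic number field whose integers contain a root `θ` of `X³ + (-1)X² + (-14)X + (34)`** (`|disc| = 11336` = `|d_K|`,
`M_K < 31`): a norm certificate — for every prime `ℓ < 31` and every root `a` of the cubic mod `ℓ` a generator `x + yθ + zθ² ∈ ℤ[θ]` of norm `±ℓ`
of the ideal `I ∋ ℓ, θ − a` (coordinates `(x, y, z)`: `ℓ = 2`: `a = 0` ↦ `(586, 105, -8)`, `a = 1` ↦ `(23, -3, -2)`; `ℓ = 3`: no root; `ℓ = 5`: `a = 1` ↦ `(12521, -8121, 1555)`, `a = 2` ↦ `(8231, 577, -325)`, `a = 3` ↦ `(145, -94, 18)`; `ℓ = 7`: no root; `ℓ = 11`: no root; `ℓ = 13`: `a = 4` ↦ `(332621867913418761163772157211367, -215735469501735202450349865145949, 41308783470508480975542377917881)`, `a = 6` ↦ `(7, -5, 1)`; `ℓ = 17`: `a = 0` ↦ `(-237609, 154111, -29509)`; `ℓ = 19`: no root; `ℓ = 23`: `a = 7` ↦ `(-137, -24, 2)`, `a = 18` ↦ `(15, -10, 2)`, `a = 22` ↦ `(-65,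 42, -8)`; `ℓ = 29`: `a = 12` ↦ `(-2999, 1211, 455)`); found by the seat's relation sieve and CHECKED HERE by the
kernel (`pow_three_eq_span_of_cert`, `Or.inl`). eng-2's PARI value (bnfcertify): `h = 1`. KERNEL. [cite: Marcus1977, Ch. 5 Thm. 35–37 and Cor. 2] [cite: Cohen1993, §6.3] -/
theorem odd_classNumber_of_root_d11336n (h3 : Module.finrank ℚ K = 3) (b : 𝓞 K)
    (hb : b ^ 3 + (-1 : ℤ) * b ^ 2 + (-14 : ℤ) * b + (34 : ℤ) = 0) : Odd (NumberField.classNumber K) := by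
  have hirr := irreducible_cubic_d11336n
  have hd : |NumberField.discr K| ≤ (11336 : ℕ) :=
    (abs_discr_le_abs_cubic_discr K h3 b hirr hb).trans (by simp only [Cubic.discr]; norm_num)
  refine odd_classNumber_of_cubeCertificate K h3 (B := 31)
    (minkowskiBound_lt_of_sqrt_le K h3 hd (s := 106.48)
      ((Real.sqrt_le_sqrt (by norm_num : ((11336 : ℕ) : ℝ) ≤ (106.48 : ℝ) ^ 2)).trans (Real.sqrt_sq (by norm_num)).le)
      (by norm_num)) ?_
  intro ℓ hℓB hℓ J hJ
  interval_cases ℓ <;> norm_num at hℓ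
  · -- `ℓ = 2`: roots [0, 1]
    refine pow_three_eq_span_of_cert K h3 b hirr hb (by norm_num) (fun a ha hdvd => ?_) hJ
    interval_cases a <;> norm_num at hdvd
    · exact Or.inl ⟨(586), (105), (-8), 1, by norm_num, by norm_num, ⟨_, by rw [Nat.cast_one, one_mul]⟩, by norm_num⟩
    · exact Or.inl ⟨(23), (-3), (-2), 1, by norm_num, by norm_num, ⟨_, by rw [Nat.cast_one, one_mul]⟩, by norm_num⟩
  · -- `ℓ = 3`: roots []
    refine pow_three_eq_span_of_cert K h3 b hirr hb (by norm_num) (fun a ha hdvd => ?_) hJ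
    interval_cases a <;> norm_num at hdvd
  · -- `ℓ = 5`: roots [1, 2, 3]
    refine pow_three_eq_span_of_cert K h3 b hirr hb (by norm_num) (fun a ha hdvd => ?_) hJ
    interval_cases a <;> norm_num at hdvd
    · exact Or.inl ⟨(12521), (-8121), (1555), 1, by norm_num, by norm_num, ⟨_, by rw [Nat.cast_one, one_mul]⟩, by norm_num⟩
    · exact Or.inl ⟨(8231), (577), (-325), 1, by norm_num, by norm_num, ⟨_, by rw [Nat.cast_one, one_mul]⟩, by norm_num⟩
    · exact Or.inl ⟨(145), (-94), (18), 1, by norm_num, by norm_num, ⟨_, by rw [Nat.cast_one, one_mul]⟩, by norm_num⟩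
  · -- `ℓ = 7`: roots []
    refine pow_three_eq_span_of_cert K h3 b hirr hb (by norm_num) (fun a ha hdvd => ?_) hJ
    interval_cases a <;> norm_num at hdvd
  · -- `ℓ = 11`: roots []
    refine pow_three_eq_span_of_cert K h3 b hirr hb (by norm_num) (fun a ha hdvd => ?_) hJ
    interval_cases a <;> norm_num at hdvd
  · -- `ℓ = 13`: roots [4, 6]
    refine pow_three_eq_span_of_cert K h3 b hirr hb (by norm_num) (fun a ha hdvd => ?_) hJ
    interval_cases a <;> norm_num at hdvd
    · exact Or.inl ⟨(332621867913418761163772157211367), (-215735469501735202450349865145949), (41308783470508480975542377917881), 1, by norm_num, by norm_num, ⟨_, by rw [Nat.cast_one, one_mul]⟩, by norm_num⟩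
    · exact Or.inl ⟨(7), (-5), (1), 1, by norm_num, by norm_num, ⟨_, by rw [Nat.cast_one, one_mul]⟩, by norm_num⟩
  · -- `ℓ = 17`: roots [0]
    refine pow_three_eq_span_of_cert K h3 b hirr hb (by norm_num) (fun a ha hdvd => ?_) hJ
    interval_cases a <;> norm_num at hdvd
    · exact Or.inl ⟨(-237609), (154111), (-29509), 1, by norm_num, by norm_num, ⟨_, by rw [Nat.cast_one, one_mul]⟩, by norm_num⟩
  · -- `ℓ = 19`: roots []
    refine pow_three_eq_span_of_cert K h3 b hirr hb (by norm_num) (fun a ha hdvd => ?_) hJ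
    interval_cases a <;> norm_num at hdvd
  · -- `ℓ = 23`: roots [7, 18, 22]
    refine pow_three_eq_span_of_cert K h3 b hirr hb (by norm_num) (fun a ha hdvd => ?_) hJ
    interval_cases a <;> norm_num at hdvd
    · exact Or.inl ⟨(-137), (-24), (2), 1, by norm_num, by norm_num, ⟨_, by rw [Nat.cast_one, one_mul]⟩, by norm_num⟩
    · exact Or.inl ⟨(15), (-10), (2), 1, by norm_num, by norm_num, ⟨_, by rw [Nat.cast_one, one_mul]⟩, by norm_num⟩
    · exact Or.inl ⟨(-65), (42), (-8), 1, by norm_num, by norm_num, ⟨_, by rw [Nat.cast_one, one_mul]⟩, by norm_num⟩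
  · -- `ℓ = 29`: roots [12]
    refine pow_three_eq_span_of_cert K h3 b hirr hb (by norm_num) (fun a ha hdvd => ?_) hJ
    interval_cases a <;> norm_num at hdvd
    · exact Or.inl ⟨(-2999), (1211), (455), 1, by norm_num, by norm_num, ⟨_, by rw [Nat.cast_one, one_mul]⟩, by norm_num⟩

end Certd11336n

/-- **Iwasawa's `μ₂ = 0` for the cubic field of discriminant `-11336`** (`ℚ(θ)`, `θ³ + (-1)θ² + (-14)θ + (34) = 0`; TWO primes above `2`,
`2 = 𝔭𝔮²`; `h` odd), KERNEL — every cyclotomic `ℤ₂`-extension of `ℚ(θ)` has `μ = 0` (growth form; indeed `e_n = 0` for all `n`).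
Chevalley's door at `2` (k4-w1 `layerOneBit_of_chevalleyCert`): the unit `ε = (-4503955094021) + (2921223649301)θ + (-559352597311)θ²` (regulator ≈ 30.92;
`ε³ + (26811866954781)ε² + (4347641)ε + (1) = 0`) has `ε ≡ 5 (mod 8)` under `θ ↦ z₂ ≡ 5` (`8 ∣ g(5)`, `g'(5)` odd), so `(ε, 2)_𝔭 = −1`: a non-norm
from `ℚ(θ, √2)`, whence `e₁ = 0`; `≤ 2` primes above `2` by `4 ∤ g(0)`, `4 ∤ g(3)`; `e₀ = 0` by `odd_classNumber_of_root_d11336n`; `n₀ = 0` by an even-index certificate `u, v, m, m'` (`u² − 2v² = 4m`, `m² = 2m'`, `8 ∤ N(2 − m'³)`; `classicalMuVanishes_two_adjoin_of_evenIndexCertificate`); Fukuda 1994 Thm. 1 (1) (`_holds`).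
The (I1M′) input of GEN 9's door for the C4″ rows 453440cv1. [cite: Fukuda1994, Thm. 1 (1), p. 264] [cite: Lang1990, Ch. 13 §4, Lemma 4.1]
[cite: Washington1997, §13.1] [cite: Greenberg2001IwasawaPastPresent, §4 (Iwasawa's μ-conjecture)] -/
theorem classicalMu_two_cubicField_d11336n {θ : AlgebraicClosure ℚ} (hθ : aeval θ (Cubic.toPoly ⟨1, ((-1 : ℤ) : ℚ), ((-14 : ℤ) : ℚ), ((34 : ℤ) : ℚ)⟩) = 0) :
    haveI : FiniteDimensional ℚ (IntermediateField.adjoin ℚ {θ}) :=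
      IntermediateField.adjoin.finiteDimensional ((AlgebraicClosure.isAlgebraic ℚ).isAlgebraic θ).isIntegral
    haveI : NumberField (IntermediateField.adjoin ℚ {θ}) := NumberField.mk
    ∀ κL : ZpExtension (IntermediateField.adjoin ℚ {θ}) 2, κL.IsCyclotomic → ClassicalMuVanishes κL := by
  intro κL hκL
  have hθ' : θ ^ 3 + (-1 : AlgebraicClosure ℚ) * θ ^ 2 + (-14 : AlgebraicClosure ℚ) * θ + (34 : AlgebraicClosure ℚ) = 0 := by
    have := hθ
    simp only [Cubic.toPoly, map_one, one_mul, aeval_add, aeval_mul, aeval_C, aeval_X_pow, aeval_X,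
      eq_ratCast, Rat.cast_intCast] at this
    push_cast at this
    linear_combination this
  have he : aeval (algebraMap ℚ (AlgebraicClosure ℚ) (((-4503955094021 : ℤ) : ℚ) / ((1 : ℤ) : ℚ)) +
      algebraMap ℚ (AlgebraicClosure ℚ) (((2921223649301 : ℤ) : ℚ) / ((1 : ℤ) : ℚ)) * θ +
      algebraMap ℚ (AlgebraicClosure ℚ) (((-559352597311 : ℤ) : ℚ) / ((1 : ℤ) : ℚ)) * θ ^ 2)
      (Cubic.toPoly ⟨1, ((26811866954781 : ℤ) : ℚ), ((4347641 : ℤ) : ℚ), ((1 : ℤ) : ℚ)⟩) = 0 := by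
    simp only [Cubic.toPoly, map_one, one_mul, aeval_add, aeval_mul, aeval_C, aeval_X_pow, aeval_X, eq_ratCast,
      Rat.cast_intCast, Rat.cast_div]
    push_cast
    linear_combination ((13309695092273209796543541673689603550 : AlgebraicClosure ℚ) + (-10041721659096184190009318351722526457 : AlgebraicClosure ℚ) * θ + (2566928795930609125600796144893336832 : AlgebraicClosure ℚ) * θ ^ 2 + (-175007627417648851509994834230391231 : AlgebraicClosure ℚ) * θ ^ 3) * hθ'
  have hh := not_two_dvd_card_classGroup_adjoin_of_forall_cubicField_odd irreducible_cubic_d11336n (odd_classNumber_of_root_d11336n) hθ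
  have h1 := layerOneBit_of_chevalleyCert irreducible_cubic_d11336n hθ hh ⟨0, by norm_num⟩ ⟨1, by norm_num⟩
      (-4503955094021) (2921223649301) (-559352597311) (1) (26811866954781) (4347641) (1) (by norm_num) he (5) (1) (by norm_num) (by norm_num) (by decide) (by decide)
  have hirr := irreducible_cubic_d11336n
  haveI : FiniteDimensional ℚ (IntermediateField.adjoin ℚ {θ}) :=
    IntermediateField.adjoin.finiteDimensional ((AlgebraicClosure.isAlgebraic ℚ).isAlgebraic θ).isIntegral
  haveI : NumberField (IntermediateField.adjoin ℚ {θ}) := NumberField.mk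
  obtain ⟨B, -, hB⟩ := exists_ringOfIntegers_cubic_root (p := -1) (q := -14) (r := 34) hθ
  have h3 := finrank_adjoin_eq_three_of_irreducible hirr hθ
  refine classicalMuVanishes_two_adjoin_of_evenIndexCertificate (p := -1) (q := -14) (r := 34) hirr hθ
    (((0 : ℤ) : 𝓞 (IntermediateField.adjoin ℚ {θ})) + ((-1 : ℤ) : 𝓞 (IntermediateField.adjoin ℚ {θ})) * B + ((1 : ℤ) : 𝓞 (IntermediateField.adjoin ℚ {θ})) * B ^ 2) (((-1 : ℤ) : 𝓞 (IntermediateField.adjoin ℚ {θ})) + ((-1 : ℤ) : 𝓞 (IntermediateField.adjoin ℚ {θ})) * B + ((0 : ℤ) : 𝓞 (IntermediateField.adjoin ℚ {θ})) * B ^ 2) (((8 : ℤ) : 𝓞 (IntermediateField.adjoin ℚ {θ})) + ((-13 : ℤ) : 𝓞 (IntermediateField.adjoin ℚ {θ})) * B + ((3 : ℤ) : 𝓞 (IntermediateField.adjoin ℚ {θ})) * B ^ 2) (((1205 : ℤ) : 𝓞 (IntermediateField.adjoin ℚ {θ})) + ((-740 : ℤ) : 𝓞 (IntermediateField.adjoin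 ℚ {θ})) * B + ((137 : ℤ) : 𝓞 (IntermediateField.adjoin ℚ {θ})) * B ^ 2) ?_ ?_ ?_
    hh κL hκL (h1 κL hκL)
  · push_cast; linear_combination (((-1 : ℤ) : 𝓞 (IntermediateField.adjoin ℚ {θ})) + ((1 : ℤ) : 𝓞 (IntermediateField.adjoin ℚ {θ})) * B + ((0 : ℤ) : 𝓞 (IntermediateField.adjoin ℚ {θ})) * B ^ 2) * hB
  · push_cast; linear_combination (((-69 : ℤ) : 𝓞 (IntermediateField.adjoin ℚ {θ})) + ((9 : ℤ) : 𝓞 (IntermediateField.adjoin ℚ {θ})) * B + ((0 : ℤ) : 𝓞 (IntermediateField.adjoin ℚ {θ})) * B ^ 2) * hB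
  · have hz : (2 : 𝓞 (IntermediateField.adjoin ℚ {θ})) - (((1205 : ℤ) : 𝓞 (IntermediateField.adjoin ℚ {θ})) + ((-740 : ℤ) : 𝓞 (IntermediateField.adjoin ℚ {θ})) * B + ((137 : ℤ) : 𝓞 (IntermediateField.adjoin ℚ {θ})) * B ^ 2) ^ 3 =
        ((-52176869343 : ℤ) : 𝓞 (IntermediateField.adjoin ℚ {θ})) + (33841394220 : ℤ) * B + (-6479895163 : ℤ) * B ^ 2 := by
      push_cast; linear_combination (((1483152330 : ℤ) : 𝓞 (IntermediateField.adjoin ℚ {θ})) + ((-289816650 : ℤ) : 𝓞 (IntermediateField.adjoin ℚ {θ})) * B + ((39095827 : ℤ) : 𝓞 (IntermediateField.adjoin ℚ {θ})) * B ^ 2 + ((-2571353 : ℤ) : 𝓞 (IntermediateField.adjoin ℚ {θ})) * B ^ 3 + ((0 : ℤ) : 𝓞 (IntermediateField.adjoin ℚ {θ})) * B ^ 4) * hB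
    rw [hz]
    exact not_eight_dvd_norm_coords _ h3 B hirr hB (-52176869343) (33841394220) (-6479895163) (N := -3190023028744125205750)
      (by simp only [Matrix.one_fin_three, Matrix.det_fin_three, Matrix.add_apply, Matrix.smul_apply, sq, Matrix.mul_apply,
        Fin.sum_univ_three, Matrix.of_apply, Matrix.cons_val', Matrix.cons_val_zero, Matrix.cons_val_one, Matrix.cons_val_two,
        Matrix.head_cons, Matrix.tail_cons, Matrix.empty_val', Matrix.cons_val_fin_one, smul_eq_mul]; norm_num) (by norm_num)

/-! ### Row `453440cv1` (cubic field `d = -11336`) -/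

/-- The census cubic model of the C4″ row `453440cv1` (`y² = x³ + (0)x² + (-2148748)x + (-1738790128)`, addL2x GEN 13 `nst_census` a-invariants) is an elliptic curve. -/
theorem isElliptic_453440cv1' : (⟨0, ((0 : ℤ) : ℚ), 0, ((-2148748 : ℤ) : ℚ), ((-1738790128 : ℤ) : ℚ)⟩ : WeierstrassCurve ℚ).IsElliptic :=
  isElliptic_cubicModel _ _ _ (by simp only [Cubic.discr]; norm_num)

/-- **UNCONDITIONAL (A)₂ for the C4″ census curve `453440cv1` — ZERO hypotheses, ZERO named facts** (additive potentially multiplicative at `2`,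
irreducible `E[2]`, `Δ < 0`; `2`-torsion cubic field `ℚ(θ)`, `θ³ + (-1)θ² + (-14)θ + (34) = 0`, `d = -11336`, `p q^2, F_q=Q2(sqrt-2)`, `h` odd). Coates–Sujatha's
statement (A) at `p = 2` for the cubic model `y² = x³ + (0)x² + (-2148748)x + (-1738790128)`: for every cyclotomic `ℤ₂`-extension of `ℚ` the dual fine Selmer group
over `ℚ_∞` is finitely generated over `ℤ₂` (`∃ γ D` currency). KERNEL: `classicalMu_two_cubicField_d11336n` above (μ₂(ℚ(θ)_cyc) = 0 for the field of `X³ + (-1)X² + (-14)X + (34)`) ⟹ cruxlead-19573-w2's `ℓ = 2` ascent to the totally complex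
`ℚ(E[2]) = ℚ(θ, √d)` and kernel Lim 3.5@2 (`TotallyComplexMu.conjA_two_cubicModel_of_classicalMu_of_discr_neg`); the root `β = x(T)` of the curve's cubic is
`150 + (-392)θ + (-2)θ²` and `ℚ(β) = ℚ(θ)`. This discharges the (I1M′) input of this row (GEN 9 `hAnaMI_negDisc_of_cubicFieldMu`) in the kernel;
it is statement (A), NOT BSD: BSD₂ for `453440cv1` is NOT proved by this. [cite: CoatesSujatha2005, Conj. A and Thm. 3.4]
[cite: Iwasawa1973MuInvariants, Thm. 2 and Thm. 3] [cite: Fukuda1994, Thm. 1 (1), p. 264] [cite: Lang1990, Ch. 13 §4, Lemma 4.1] -/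
theorem conjA_two_453440cv1' (κ : ZpExtension ℚ 2) (hκ : κ.IsCyclotomic) :
    haveI := isElliptic_453440cv1'
    ∃ (γ : absoluteGaloisGroup ℚ) (D : (⟨0, ((0 : ℤ) : ℚ), 0, ((-2148748 : ℤ) : ℚ), ((-1738790128 : ℤ) : ℚ)⟩ : WeierstrassCurve ℚ).FineSelmerDualData κ γ),
      Module.Finite ℤ_[2] (RestrictScalars ℤ_[2] (IwasawaAlgebra 2) D.X) := by
  haveI := isElliptic_453440cv1'
  obtain ⟨θ, hθ⟩ : ∃ θ : AlgebraicClosure ℚ, aeval θ (Cubic.toPoly ⟨1, ((-1 : ℤ) : ℚ), ((-14 : ℤ) : ℚ), ((34 : ℤ) : ℚ)⟩) = 0 :=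
    IsAlgClosed.exists_aeval_eq_zero _ _ (by rw [Cubic.degree_of_a_ne_zero one_ne_zero]; norm_num)
  have hθ' : θ ^ 3 + (-1 : AlgebraicClosure ℚ) * θ ^ 2 + (-14 : AlgebraicClosure ℚ) * θ + (34 : AlgebraicClosure ℚ) = 0 := by
    have := hθ
    simp only [Cubic.toPoly, map_one, one_mul, aeval_add, aeval_mul, aeval_C, aeval_X_pow, aeval_X,
      eq_ratCast, Rat.cast_intCast] at this
    push_cast at this
    linear_combination this
  set β : AlgebraicClosure ℚ := algebraMap ℚ (AlgebraicClosure ℚ) (150 : ℚ) +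
      algebraMap ℚ (AlgebraicClosure ℚ) (-392 : ℚ) * θ + algebraMap ℚ (AlgebraicClosure ℚ) (-2 : ℚ) * θ ^ 2 with hβdef
  have hβ : aeval β (Cubic.toPoly ⟨1, ((0 : ℤ) : ℚ), ((-2148748 : ℤ) : ℚ), ((-1738790128 : ℤ) : ℚ)⟩) = 0 := by
    simp only [Cubic.toPoly, map_one, one_mul, aeval_add, aeval_mul, aeval_C, aeval_X_pow, aeval_X, eq_ratCast,
      Rat.cast_intCast]
    rw [hβdef]
    simp only [eq_ratCast]
    push_cast
    linear_combination ((-60521392 : AlgebraicClosure ℚ) + (-925008 : AlgebraicClosure ℚ) * θ + (-4712 : AlgebraicClosure ℚ) * θ ^ 2 + (-8 : AlgebraicClosure ℚ) * θ ^ 3) * hθ'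
  have hadj : IntermediateField.adjoin ℚ {β} = IntermediateField.adjoin ℚ {θ} := by
    apply le_antisymm
    · rw [IntermediateField.adjoin_simple_le_iff, hβdef]
      have hθmem := IntermediateField.mem_adjoin_simple_self ℚ θ
      exact add_mem (add_mem (algebraMap_mem _ _) (mul_mem (algebraMap_mem _ _) hθmem))
        (mul_mem (algebraMap_mem _ _) (pow_mem hθmem 2))
    · rw [IntermediateField.adjoin_simple_le_iff]
      have hθeq : θ = algebraMap ℚ (AlgebraicClosure ℚ) (1446369/3801920 : ℚ) +
          algebraMap ℚ (AlgebraicClosure ℚ) (-38673/15207680 : ℚ) * β +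
          algebraMap ℚ (AlgebraicClosure ℚ) (-1/30415360 : ℚ) * β ^ 2 := by
        rw [hβdef]; simp only [eq_ratCast]; push_cast
        linear_combination (((393 : AlgebraicClosure ℚ) / 7603840) + ((1 : AlgebraicClosure ℚ) / 7603840) * θ) * hθ'
      rw [hθeq]
      have hβmem := IntermediateField.mem_adjoin_simple_self ℚ β
      exact add_mem (add_mem (algebraMap_mem _ _) (mul_mem (algebraMap_mem _ _) hβmem))
        (mul_mem (algebraMap_mem _ _) (pow_mem hβmem 2))
  have h3 : Module.finrank ℚ (IntermediateField.adjoin ℚ {β}) = 3 := by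
    rw [hadj]; exact finrank_adjoin_eq_three_of_irreducible irreducible_cubic_d11336n hθ
  exact TotallyComplexMu.conjA_two_cubicModel_of_classicalMu_of_discr_neg (0) (-2148748) (-1738790128)
    (irreducible_cubic_of_finrank_adjoin_eq_three hβ h3) (by simp only [Cubic.discr]; norm_num) hβ
    (by rw [hadj]; exact classicalMu_two_cubicField_d11336n hθ) κ hκ
end Summit.BirchSwinnertonDyer.BirchSwinnertonDyer.Theorems.AddKatoTwo

end
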